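import Literature.Barriers.Schanuel.NesterenkoModularScopeGradingProofs
import Literature.Barriers.Schanuel.NesterenkoModularScopeMultiplicityProofs
import Mathlib.RingTheory.PowerSeries.Inverse
import HarnessLib

/-!
# Barrier (Schanuel) `NesterenkoModularScope`: integrality of the cofactor and the formal differential equations in the proof of LNM 1752 Ch. 10 Lemma 5.2 — proofs only

`Literature/Barriers/Schanuel/NesterenkoModularScopeDarbouxProofs.lean` — proofs-only, second part
of the proof of LNM 1752 Ch. 10 Lemma 5.2 (`NesterenkoPhilippon2001_ch10_lemma_5_2`) from Mahler's
theorem (`Mahler1969_ramanujan_algIndep`). No new definitions. Content (notation of the printed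
proof, pp. 162–163: `DA = (ax₁ + b)A`):

* `exists_nat_eq_of_ramanujanD_eq_mul` — "`b = deg_z C ∈ ℤ`" from the part `C` of `A` of minimal
  weight (here: minimal `𝔴`-weight, `𝔴 = (2, 1, 2, 3)`; `z∂C/∂z = bC`, so `b` is the exponent of `z`
  in any monomial of `C`, a natural number);
* `natCast_order_eq_of_ramanujanD_eq_mul` — "`(a + b)c_m = mc_m`, `a + b = m`" where
  `m = ord A(z, P, Q, R)` (finite by Mahler's theorem), from identity (41);
* `exists_C_mul_of_ramanujanTheta_mul_eq` — the formal version of "`d/dz g = 0`, hence `g` is a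
  constant": if `θf · g = f · θg` in `ℂ⟦z⟧`, `g ≠ 0`, then `f = c·g`;
* `exists_eq_C_mul_of_ramanujanD_eq` — "`DS = 0` … `S(z, P, Q, R)` is a constant … Hence `S = c`"
  in polynomial form: if `DU = UL`, `DV = VL`, `U, V ≠ 0`, then `U = cV` (Mahler's theorem applied
  to `U − cV`).

## References

* [NesterenkoPhilippon2001] LNM 1752 (2001), Ch. 10 §5, proof of Lemma 5.2 (74), (75) (pp. 162–163).
-/

noncomputable section

open MvPolynomial
open Literature.NumberTheory.Transcendental

namespace Literature.Barriers.Schanuel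

/-! ### `b ∈ ℕ` from the component of minimal weight -/

/-- **"`b = deg_z C ∈ ℤ`"**: if `DA = A(b + a x₁)` with `A ≠ 0` then `b` is a natural number (the
`z`-exponent of a monomial of the minimal-weight part `C` of `A`, for which `z ∂C/∂z = bC`).
[cite: NesterenkoPhilippon2001, Ch. 10 §5, proof of Lemma 5.2 (p. 162)] -/
theorem exists_nat_eq_of_ramanujanD_eq_mul {A : MvPolynomial (Fin 4) ℂ} (hA : A ≠ 0) {α β : ℂ}
    (h : ramanujanD A = A * (C β + C α * X 1)) : ∃ b : ℕ, β = b := by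
  classical
  have hex : ∃ n, weightedHomogeneousComponent (![2, 1, 2, 3] : Fin 4 → ℕ) n A ≠ 0 :=
    ⟨_, weightedHomogeneousComponent_weightedTotalDegree_ne_zero hA⟩
  have hC : weightedHomogeneousComponent (![2, 1, 2, 3] : Fin 4 → ℕ) (Nat.find hex) A ≠ 0 := Nat.find_spec hex
  have hlow : ∀ n < Nat.find hex, weightedHomogeneousComponent (![2, 1, 2, 3] : Fin 4 → ℕ) n A = 0 := fun n hn => by
    have := Nat.find_min hex hn
    push Not at this
    exact this
  set w₀ := Nat.find hex with hw₀def
  have hw₀le : w₀ ≤ A.weightedTotalDegree (![2, 1, 2, 3] : Fin 4 → ℕ) := by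
    by_contra hlt
    push Not at hlt
    exact hC (weightedHomogeneousComponent_eq_zero w₀ A hlt)
  have e1 : ((![2, 1, 2, 3] : Fin 4 → ℕ) 1 : ℕ) = 1 := rfl
  -- the component of weight `w₀` of `DA` is `z ∂C/∂z`
  have hL : weightedHomogeneousComponent (![2, 1, 2, 3] : Fin 4 → ℕ) w₀ (ramanujanD A) =
      X 0 * pderiv 0 (weightedHomogeneousComponent (![2, 1, 2, 3] : Fin 4 → ℕ) w₀ A) := by
    conv_lhs => rw [← sum_range_weightedHomogeneousComponent A, map_sum]
    have hsplit : ∀ n, ramanujanD (weightedHomogeneousComponent (![2, 1, 2, 3] : Fin 4 → ℕ) n A) =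
        X 0 * pderiv 0 (weightedHomogeneousComponent (![2, 1, 2, 3] : Fin 4 → ℕ) n A) +
          (ramanujanD (weightedHomogeneousComponent (![2, 1, 2, 3] : Fin 4 → ℕ) n A) -
            X 0 * pderiv 0 (weightedHomogeneousComponent (![2, 1, 2, 3] : Fin 4 → ℕ) n A)) := fun n => by ring
    rw [Finset.sum_congr rfl (fun n _ => hsplit n), Finset.sum_add_distrib, map_add,
      weightedHomogeneousComponent_sum_of_isWeightedHomogeneous _ _ (fun n => n)
        (fun n _ => isWeightedHomogeneous_X_mul_pderiv 0
          (weightedHomogeneousComponent_isWeightedHomogeneous n A)),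
      weightedHomogeneousComponent_sum_of_isWeightedHomogeneous _ _ (fun n => n + 1)
        (fun n _ => isWeightedHomogeneous_ramanujanD_sub
          (weightedHomogeneousComponent_isWeightedHomogeneous n A)),
      Finset.sum_ite_eq', if_pos (Finset.mem_range.mpr (by omega))]
    rw [Finset.sum_eq_zero, add_zero]
    intro n hn
    split_ifs with hn1
    · rw [hlow n (by omega), map_zero, map_zero, mul_zero, sub_zero]
    · rfl
  -- the component of weight `w₀` of `A(b + a x₁)` is `bC`
  have hR : weightedHomogeneousComponent (![2, 1, 2, 3] : Fin 4 → ℕ) w₀ (A * (C β + C α * X 1)) =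
      C β * weightedHomogeneousComponent (![2, 1, 2, 3] : Fin 4 → ℕ) w₀ A := by
    have e : A * (C β + C α * X 1) = C β * A + C α * (X 1 * A) := by ring
    rw [e, map_add, weightedHomogeneousComponent_C_mul, weightedHomogeneousComponent_C_mul]
    have hX : weightedHomogeneousComponent (![2, 1, 2, 3] : Fin 4 → ℕ) w₀ (X 1 * A) = 0 := by
      conv_lhs => rw [← sum_range_weightedHomogeneousComponent A, Finset.mul_sum]
      rw [weightedHomogeneousComponent_sum_of_isWeightedHomogeneous _ _ (fun n => n + 1)
        (fun n _ => ?_)]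
      · refine Finset.sum_eq_zero fun n hn => ?_
        split_ifs with hn1
        · rw [hlow n (by omega), mul_zero]
        · rfl
      · have := (isWeightedHomogeneous_X ℂ (![2, 1, 2, 3] : Fin 4 → ℕ) 1).mul
          (weightedHomogeneousComponent_isWeightedHomogeneous n A)
        rw [e1, add_comm] at this
        exact this
    rw [hX, mul_zero, add_zero]
  have key : X 0 * pderiv 0 (weightedHomogeneousComponent (![2, 1, 2, 3] : Fin 4 → ℕ) w₀ A) =
      C β * weightedHomogeneousComponent (![2, 1, 2, 3] : Fin 4 → ℕ) w₀ A := by rw [← hL, h, hR]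
  obtain ⟨d, hd⟩ := ne_zero_iff.mp hC
  have hkey := congrArg (coeff d) key
  rw [coeff_X_mul', coeff_C_mul] at hkey
  split_ifs at hkey with h0
  · rw [coeff_pderiv, tsub_add_cancel_of_le (Finsupp.single_le_iff.mpr
      (Nat.one_le_iff_ne_zero.mpr (Finsupp.mem_support_iff.mp h0)))] at hkey
    have hd0 : 1 ≤ d 0 := Nat.one_le_iff_ne_zero.mpr (Finsupp.mem_support_iff.mp h0)
    have ecast : (((d - Finsupp.single (0 : Fin 4) 1 : Fin 4 →₀ ℕ) 0 : ℕ) : ℂ) + 1 = (d 0 : ℂ) := by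
      rw [Finsupp.tsub_apply, Finsupp.single_eq_same]
      push_cast [Nat.cast_sub hd0]
      ring
    rw [ecast, mul_comm] at hkey
    exact ⟨d 0, (mul_right_cancel₀ hd hkey).symm⟩
  · refine ⟨0, ?_⟩
    rcases mul_eq_zero.mp hkey.symm with h1 | h1
    · rw [h1, Nat.cast_zero]
    · exact absurd h1 hd

/-! ### `a + b = ord A(z, P, Q, R)` -/

/-- `θ (zᵐ) = m zᵐ`. [folklore] -/
theorem ramanujanTheta_X_pow (m : ℕ) :
    ramanujanTheta (PowerSeries.X ^ m : PowerSeries ℂ) = PowerSeries.C (m : ℂ) * PowerSeries.X ^ m := by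
  ext n
  rw [coeff_ramanujanTheta, PowerSeries.coeff_C_mul, PowerSeries.coeff_X_pow]
  split_ifs with h
  · rw [h]
  · simp

/-- The composite of `F · (b + a x₁)` is `F(ω̄) · (b + a P)`. [folklore] -/
theorem ramanujanComposite_mul_C_add_C_mul_X (F : MvPolynomial (Fin 4) ℂ) (α β : ℂ) :
    ramanujanComposite (F * (C β + C α * X 1)) = ramanujanComposite F *
      (PowerSeries.C β + PowerSeries.C α * (ramanujanPSeries).map (Int.castRingHom ℂ)) := by
  unfold ramanujanComposite
  rw [map_mul, map_add, map_mul, MvPolynomial.aeval_C, MvPolynomial.aeval_C, MvPolynomial.aeval_X,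
    ← PowerSeries.C_eq_algebraMap, ← PowerSeries.C_eq_algebraMap]
  rfl

/-- **"`a + b = m`"**: if `DF = F(b + a x₁)` and `F ≠ 0` then `a + b = ord_{z=0} F(z, P, Q, R)`
(finite by Mahler's theorem): compare the coefficients of `zᵐ` in
`z d/dz F(ω̄) = (aP + b) F(ω̄)` (identity (41)), `P(0) = 1`.
[cite: NesterenkoPhilippon2001, Ch. 10 §5, proof of Lemma 5.2 (p. 162)] -/
theorem natCast_order_eq_of_ramanujanD_eq_mul (hM : Mahler1969_ramanujan_algIndep)
    {F : MvPolynomial (Fin 4) ℂ} (hF : F ≠ 0) {α β : ℂ}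
    (h : ramanujanD F = F * (C β + C α * X 1)) :
    (((ramanujanComposite F).order).toNat : ℂ) = α + β := by
  set f := ramanujanComposite F with hf
  set L := PowerSeries.C β + PowerSeries.C α * (ramanujanPSeries).map (Int.castRingHom ℂ) with hL
  have hf0 : f ≠ 0 := hM F hF
  have hθ : ramanujanTheta f = f * L := by
    rw [hf, ← ramanujanComposite_ramanujanD, h, ramanujanComposite_mul_C_add_C_mul_X]
  set m := f.order.toNat with hm
  set g := f.divXPowOrder with hg
  have hfg : PowerSeries.X ^ m * g = f := PowerSeries.X_pow_order_mul_divXPowOrder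
  have hg0 : PowerSeries.constantCoeff g ≠ 0 := by
    rw [Ne, PowerSeries.constantCoeff_divXPowOrder_eq_zero_iff]
    exact hf0
  clear_value m g
  rw [← hfg, ramanujanTheta_mul, ramanujanTheta_X_pow] at hθ
  -- cancel `zᵐ`
  have h1 : PowerSeries.X ^ m * (PowerSeries.C (m : ℂ) * g + ramanujanTheta g) =
      PowerSeries.X ^ m * (g * L) := by
    rw [← sub_eq_zero]
    rw [← sub_eq_zero] at hθ
    rw [← hθ]
    ring
  have h2 := mul_left_cancel₀ (pow_ne_zero m PowerSeries.X_ne_zero) h1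
  -- constant coefficients
  have h3 := congrArg PowerSeries.constantCoeff h2
  have hθ0 : PowerSeries.constantCoeff (ramanujanTheta g) = 0 := by
    rw [← PowerSeries.coeff_zero_eq_constantCoeff_apply, coeff_ramanujanTheta, Nat.cast_zero,
      zero_mul]
  have hP0 : PowerSeries.constantCoeff ((ramanujanPSeries).map (Int.castRingHom ℂ)) = 1 := by
    rw [← PowerSeries.coeff_zero_eq_constantCoeff_apply, PowerSeries.coeff_map,
      constantCoeff_ramanujanSeries.1, map_one]
  simp only [map_add, map_mul, PowerSeries.constantCoeff_C, hθ0, add_zero, hL, hP0, mul_one] at h3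
  -- h3 : ↑m * g₀ = g₀ * (β + α)
  have h4 : ((m : ℂ) - (α + β)) * PowerSeries.constantCoeff g = 0 := by
    rw [sub_mul, h3]; ring
  rcases mul_eq_zero.mp h4 with h5 | h5
  · exact sub_eq_zero.mp h5
  · exact absurd h5 hg0

/-! ### The formal differential equations -/

/-- **"`d/dz g(z) = 0`, hence `g` is a constant"**, formal version: if `θf · g = f · θg` in `ℂ⟦z⟧`
with `g ≠ 0` (i.e. `θ(f/g) = 0`), then `f = c g` for a constant `c`.
[cite: NesterenkoPhilippon2001, Ch. 10 §5, proof of Lemma 5.2 (p. 163)] -/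
theorem exists_C_mul_of_ramanujanTheta_mul_eq {f g : PowerSeries ℂ} (hg : g ≠ 0)
    (h : ramanujanTheta f * g = f * ramanujanTheta g) : ∃ c : ℂ, f = PowerSeries.C c * g := by
  set k := g.order.toNat with hk
  set g₀ := g.divXPowOrder with hg₀def
  have hg₀ : PowerSeries.constantCoeff g₀ ≠ 0 := by
    rw [Ne, PowerSeries.constantCoeff_divXPowOrder_eq_zero_iff]
    exact hg
  have hg₀' : g₀ ≠ 0 := fun h0 => hg₀ (by rw [h0, map_zero])
  have hgk : PowerSeries.X ^ k * g₀ = g := PowerSeries.X_pow_order_mul_divXPowOrder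
  set r := f * g₀⁻¹ with hr
  clear_value k g₀ r
  have hfr : f = r * g₀ := by
    rw [hr, mul_assoc, PowerSeries.inv_mul_cancel _ hg₀, mul_one]
  have key : ramanujanTheta r = PowerSeries.C (k : ℂ) * r := by
    rw [hfr, ← hgk, ramanujanTheta_mul, ramanujanTheta_mul, ramanujanTheta_X_pow] at h
    have h' : PowerSeries.X ^ k * g₀ * g₀ * (ramanujanTheta r - PowerSeries.C (k : ℂ) * r) = 0 := by
      linear_combination h
    have hne : PowerSeries.X ^ k * g₀ * g₀ ≠ 0 :=
      mul_ne_zero (mul_ne_zero (pow_ne_zero _ PowerSeries.X_ne_zero) hg₀') hg₀'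
    rcases mul_eq_zero.mp h' with h'' | h''
    · exact absurd h'' hne
    · exact sub_eq_zero.mp h''
  have hcoeff : ∀ n, n ≠ k → PowerSeries.coeff n r = 0 := by
    intro n hn
    have h1 := congrArg (PowerSeries.coeff n) key
    rw [coeff_ramanujanTheta, PowerSeries.coeff_C_mul] at h1
    have h2 : ((n : ℂ) - k) * PowerSeries.coeff n r = 0 := by rw [sub_mul, h1, sub_self]
    rcases mul_eq_zero.mp h2 with h3 | h3
    · exact absurd (by exact_mod_cast sub_eq_zero.mp h3) hn
    · exact h3
  have hrk : r = PowerSeries.C (PowerSeries.coeff k r) * PowerSeries.X ^ k := by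
    ext n
    rw [PowerSeries.coeff_C_mul, PowerSeries.coeff_X_pow]
    split_ifs with hn
    · rw [hn, mul_one]
    · rw [hcoeff n hn, mul_zero]
  refine ⟨PowerSeries.coeff k r, ?_⟩
  calc f = r * g₀ := hfr
    _ = (PowerSeries.C (PowerSeries.coeff k r) * PowerSeries.X ^ k) * g₀ := by rw [← hrk]
    _ = PowerSeries.C (PowerSeries.coeff k r) * g := by rw [mul_assoc, hgk]

/-- **"`DS = 0` … hence `S = c`"** in polynomial form: if `DU = UL` and `DV = VL` with
`U, V ≠ 0`, then `U = cV` for a constant `c ≠ 0` — the composites satisfy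
`θ(U(ω̄)) V(ω̄) = U(ω̄) θ(V(ω̄))` by (41), so `U(ω̄) = c V(ω̄)`, and `U − cV` vanishes at `ω̄`, hence is
zero by Mahler's theorem. [cite: NesterenkoPhilippon2001, Ch. 10 §5, proof of Lemma 5.2 (75) (p. 163)] -/
theorem exists_eq_C_mul_of_ramanujanD_eq (hM : Mahler1969_ramanujan_algIndep)
    {U V L : MvPolynomial (Fin 4) ℂ} (hU : U ≠ 0) (hV : V ≠ 0)
    (hDU : ramanujanD U = U * L) (hDV : ramanujanD V = V * L) :
    ∃ c : ℂ, c ≠ 0 ∧ U = C c * V := by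
  have hcomp_mul : ∀ p q : MvPolynomial (Fin 4) ℂ,
      ramanujanComposite (p * q) = ramanujanComposite p * ramanujanComposite q := fun p q => by
    unfold ramanujanComposite; exact map_mul _ _ _
  have hcomp_sub : ∀ p q : MvPolynomial (Fin 4) ℂ,
      ramanujanComposite (p - q) = ramanujanComposite p - ramanujanComposite q := fun p q => by
    unfold ramanujanComposite; exact map_sub _ _ _
  have hcomp_C : ∀ c : ℂ, ramanujanComposite (C c : MvPolynomial (Fin 4) ℂ) = PowerSeries.C c :=
    fun c => by
    unfold ramanujanComposite; rw [MvPolynomial.aeval_C, ← PowerSeries.C_eq_algebraMap]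
  have hu : ramanujanTheta (ramanujanComposite U) = ramanujanComposite U * ramanujanComposite L := by
    rw [← ramanujanComposite_ramanujanD, hDU, hcomp_mul]
  have hv : ramanujanTheta (ramanujanComposite V) = ramanujanComposite V * ramanujanComposite L := by
    rw [← ramanujanComposite_ramanujanD, hDV, hcomp_mul]
  have hθ : ramanujanTheta (ramanujanComposite U) * ramanujanComposite V =
      ramanujanComposite U * ramanujanTheta (ramanujanComposite V) := by
    rw [hu, hv]; ring
  obtain ⟨c, hc⟩ := exists_C_mul_of_ramanujanTheta_mul_eq (hM V hV) hθ
  have hUV : U - C c * V = 0 := by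
    by_contra hne
    apply hM _ hne
    rw [hcomp_sub, hcomp_mul, hcomp_C, hc, sub_self]
  refine ⟨c, ?_, sub_eq_zero.mp hUV⟩
  rintro rfl
  rw [C_0, zero_mul, sub_zero] at hUV
  exact hU hUV

end Literature.Barriers.Schanuel

end
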